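import Literature.AlgebraicGeometry.Motives.HodgeStructureCentralizerRestrictionToRepresentativesPoints
import Literature.AlgebraicGeometry.Motives.HodgeStructureInternalBlocksHomOrthogonalityCriterion
import HarnessLib

/-!
# «`C(A) ⊂ C(A₁) × ⋯ × C(A_s)`, WITH EQUALITY HOLDING IF AND ONLY IF `Hom(Aᵢ, Aⱼ) = 0` FOR ALL `i ≠ j`» ON `K`-POINTS, WITH FORMULAS:
# for every field `K ⊇ ℚ` and every internal direct sum `V = ⊕_k W_k` of sub-Hodge structures, restriction to the base-changed
# blocks is an injective homomorphism of `K`-algebras `C(H)(K) ↪ Π_k C(W_k)(K)`, `(ι_k)_K ((r c)_k x) = c ((ι_k)_K x)`, bijective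
# iff the blocks are Hom-orthogonal iff `dim_K C(H)(K) = Σ_k dim_K C(W_k)(K)` iff every `K`-family lifts
# (Milne 1999 §1 p. 643 L13–L15, Prop. 1.1, Remark 1.6)

[topic AlgebraicGeometry/Motives]

Layer `Literature/AlgebraicGeometry/Motives`, lane `lit-hodgefound` (Track 2 foundations library; prover seat
`lit-hodgefound-p02`, generation 53, self-proposed row g53-#10). THEOREMS ONLY: no definition, no named fact (net debt `0`),
no instance, no notation.  The `K`-points companion, WITH FORMULAS, of g52-#3 (`Motives/HodgeStructureCentralizerInternalBlocks`:
`C(H) ↪ Π_k C(W_k)`, `≃` for Hom-orthogonal blocks, `(e c)_k v = c v`) and g52-#7 (`Motives/HodgeStructureInternalBlocksHomOrthogonalityCriterion`: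
lifting ⟺ isomorphism ⟺ Hom-orthogonal ⟺ dimension count); g52-#10 (`Motives/HodgeStructureCentralizerInternalBlocksPoints`) has the
`K`-point isomorphisms only as bare `Nonempty`.  Built by transporting g52-#3's restriction homomorphism through Remark 1.6 in the
canonical form of g53-#5 (`exists_baseChange_centralizer_algEquiv : K ⊗_ℚ C(·) ≃ₐ[K] C(·)(K)`, `k ⊗ γ ↦ k · γ_K`,
`finrank_centralizer_endAlg_baseChange_eq`, `finite_centralizer_endAlg_baseChange`) and Mathlib's `Algebra.TensorProduct.piRight`,
as g53-#6 (`Motives/HodgeStructureCentralizerRestrictionToRepresentativesPoints`, whose `Polarization.restrict_form_baseChange_apply` is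
used) does over the representatives; the criterion is g52-#7's `finrank_centralizer_eq_sum_iff_hom_orthogonal` read through the
dimension identities — all BY NAME, nothing restated.

## The source, verbatim

J. S. Milne, *Lefschetz classes on abelian varieties*, Duke Math. J. 96 (1999) 639–675 [Milne1999LefschetzClasses] (held
`paper:doi-10-1215-s0012-7094-99-09620-5`), §1 p. 643 L13–L15: "If `B` is isogenous to `A₁ × ⋯ × A_s`, then
`C(B) ⊂ C(A₁) × ⋯ × C(A_s)`, with equality holding if and only if `Hom(Aᵢ, Aⱼ) = 0` for all `i ≠ j`."; p. 644 L29–L34: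
"**Remark 1.6.** […] there are canonical isomorphisms `C'(A) ≅ C(A) ⊗_k k'`, `S'(A) ≅ S(A)_{/k'}`."  Also C. Voisin
[VoisinHodgeI2002] §7.3.1 Lemma 7.26 (sub-Hodge structures and projections), N. Bourbaki [BourbakiAlgebraI1989] Ch. II §5 no. 3
Prop. 7 (base change of homomorphism modules; flatness of `K/ℚ`), D. Huybrechts [Huybrechts2016K3] §3.3.5 eq. (3.3).

## Dictionary and what is proved (namespace `Literature.AlgebraicGeometry.Motives.HodgeStructure`)

`C(H)(K) = Subalgebra.centralizer K {a_K : a ∈ E_φ(H)} ⊆ End_K(K ⊗_ℚ V)`, `(ι_k)_K = (W k).toSubmodule.subtype.baseChange K`,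
`†_K = ψ.adjointBaseChange K` (`ψ.centralizerAdjoint K` on `C(H)(K)`); Hom-orthogonal: `∀ k ≠ l, Hom(W_k, W_l) = 0`.

* §1 `subtype_comp_coe_pi_eq_of_forall_coe_apply_eq`, `piRight_apply_eq_map_evalAlgHom` (the components of `K ⊗ Π = Π K ⊗`),
  **`subtype_baseChange_piRight_map_apply_eq`** (the base change
  `(Π_k κ_{W_k}) ∘ piRight ∘ (K ⊗ φ)` of ANY `φ : C(H) →ₐ[ℚ] Π_k C(W_k)` over the restrictions lies over the base-changed restrictions,
  relative to `κ_H : K ⊗ C(H) ⥲ C(H)(K)`), `linearMap_eq_of_forall_apply_subtype_baseChange_eq` (the `(ι_k)_K (K ⊗ W_k)` span `K ⊗ V`), `centralizer_baseChange_pi_map_eq_of_forall_subtype_baseChange_apply_eq` (uniqueness of a map over the restrictions),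
  `Polarization.coe_map_centralizerAdjoint_eq_adjointBaseChange_of_forall_subtype_baseChange_apply_eq` (ANY map over the restrictions
  carries `†_K` to `Π_k †_{K,k}`), **`exists_algHom_pi_centralizer_baseChange`** («`C(B) ⊂ ΠC(Aᵢ)`» on `K`-points: an INJECTIVE
  `r : C(H)(K) →ₐ[K] Π_k C(W_k)(K)` with `(ι_k)_K ((r c)_k x) = c ((ι_k)_K x)`).
* §2 **`finrank_centralizer_baseChange_eq_sum_iff_hom_orthogonal`**, **`exists_algEquiv_pi_centralizer_baseChange_of_hom_orthogonal`**
  (`∃ E : C(H)(K) ≃ₐ[K] Π_k C(W_k)(K)` over the restrictions), `exists_algEquiv_pi_centralizer_baseChange_of_forall_stable`,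
  `Polarization.exists_algEquiv_pi_centralizer_baseChange_adjoint_of_hom_orthogonal` (with `†_K`),
`eq_zero_of_one_tmul_eq_zero` (`w ↦ 1 ⊗ w` is injective), **`hom_eq_zero_of_forall_exists_centralizer_baseChange_lift`** (lift
  `(1, 0, …, 0)`: Milne's argument on `K`-points), **`forall_exists_centralizer_baseChange_lift_iff_hom_orthogonal`**,
  **`exists_algEquiv_pi_centralizer_baseChange_iff_hom_orthogonal`** («with equality iff `Hom(Aᵢ, Aⱼ) = 0`» on `K`-points:
  isomorphism ⟺ lifting ⟺ Hom-orthogonal ⟺ dimension count).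
* §3 `Polarization.exists_algEquiv_pi_centralizer_baseChange_minimal_stable_adjoint` (over the CANONICAL blocks of a polarized `H`:
  `(C(H)(K), †_K) ≃ₐ Π_S (C(S)(K), †_K)` by restriction).
-/

noncomputable section

open scoped TensorProduct

namespace Literature.AlgebraicGeometry.Motives

namespace HodgeStructure

universe u uK

variable (K : Type uK) [Field K] [Algebra ℚ K] {V : Type u} [AddCommGroup V] [Module ℚ V] {n : ℤ} {H : HodgeStructure V n}

/-! ## §1 Restriction to the base-changed blocks `C(H)(K) ↪ Π_k C(W_k)(K)`, with its formula -/

section Blocks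

variable {κ : Type*} [Fintype κ] [DecidableEq κ] (W : κ → SubHodgeStructure H)
  (hW : DirectSum.IsInternal fun k => (W k).toSubmodule)

omit [Fintype κ] [DecidableEq κ] in
/-- The `ℚ`-formula `(e c)_k v = c v`, read as `ι_k ∘ (e c)_k = c ∘ ι_k : W_k → V`. [cite: Milne1999LefschetzClasses, §1 p. 643 L13–L15] -/
theorem subtype_comp_coe_pi_eq_of_forall_coe_apply_eq
    (e : Subalgebra.centralizer ℚ (H.endAlg : Set (Module.End ℚ V)) →
      Π k, Subalgebra.centralizer ℚ ((W k).toHodgeStructure.endAlg : Set (Module.End ℚ (W k).toSubmodule)))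
    (he : ∀ (c : Subalgebra.centralizer ℚ (H.endAlg : Set (Module.End ℚ V))) (k : κ) (v : (W k).toSubmodule),
      ((e c k : Module.End ℚ (W k).toSubmodule) v : V) = (c : Module.End ℚ V) v)
    (c : Subalgebra.centralizer ℚ (H.endAlg : Set (Module.End ℚ V))) (k : κ) :
    (W k).toSubmodule.subtype ∘ₗ (e c k : Module.End ℚ (W k).toSubmodule) = (c : Module.End ℚ V) ∘ₗ (W k).toSubmodule.subtype :=
  LinearMap.ext fun v => he c k v

include hW

omit [Fintype κ] in
/-- **The `(ι_k)_K (K ⊗ W_k)` span `K ⊗ V`** (`V = ⊕_k W_k`): two `K`-linear maps out of `K ⊗ V` agreeing on every `(ι_k)_K x` are equal.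
[cite: Milne1999LefschetzClasses, §1 Remark 1.6 (p. 644)] [cite: BourbakiAlgebraI1989, Ch. II §5 no. 3 Prop. 7] -/
theorem linearMap_eq_of_forall_apply_subtype_baseChange_eq {M : Type*} [AddCommMonoid M] [Module K M] (f g : K ⊗[ℚ] V →ₗ[K] M)
    (h : ∀ (k : κ) (x : K ⊗[ℚ] (W k).toSubmodule), f ((W k).toSubmodule.subtype.baseChange K x) = g ((W k).toSubmodule.subtype.baseChange K x)) :
    f = g := by
  refine LinearMap.ext fun x => ?_
  induction x using TensorProduct.induction_on with
  | zero => rw [map_zero, map_zero]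
  | add x x' hx hx' => rw [map_add, map_add, hx, hx']
  | tmul a v =>
    have hv : v ∈ ⨆ k, (W k).toSubmodule := by rw [hW.submodule_iSup_eq_top]; exact Submodule.mem_top
    induction hv using Submodule.iSup_induction' with
    | mem k v hv =>
      have hkv : a ⊗ₜ[ℚ] v = (W k).toSubmodule.subtype.baseChange K (a ⊗ₜ[ℚ] ⟨v, hv⟩) := by
        rw [LinearMap.baseChange_tmul, Submodule.subtype_apply]
      rw [hkv, h]
    | zero => rw [TensorProduct.tmul_zero, map_zero, map_zero]
    | add v v' _ _ hv hv' => rw [TensorProduct.tmul_add, map_add, map_add, hv, hv']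

omit [Fintype κ] [DecidableEq κ] hW in
/-- **Uniqueness of a map over the restrictions, on `K`-points**: two maps `E, E' : C(H)(K) → Π_k C(W_k)(K)` with
`(ι_k)_K ((E c)_k x) = c ((ι_k)_K x) = (ι_k)_K ((E' c)_k x)` COINCIDE (`(ι_k)_K` is injective, `K` being flat over `ℚ`).
[cite: Milne1999LefschetzClasses, §1 Prop. 1.1 (p. 643) and Remark 1.6 (p. 644)] [cite: BourbakiAlgebraI1989, Ch. II §5 no. 3 Prop. 7] -/
theorem centralizer_baseChange_pi_map_eq_of_forall_subtype_baseChange_apply_eq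
    (E E' : Subalgebra.centralizer K ((fun a : Module.End ℚ V => a.baseChange K) '' (H.endAlg : Set (Module.End ℚ V))) →
      Π k, Subalgebra.centralizer K ((fun a : Module.End ℚ (W k).toSubmodule => a.baseChange K) ''
        ((W k).toHodgeStructure.endAlg : Set (Module.End ℚ (W k).toSubmodule))))
    (hE : ∀ (c : Subalgebra.centralizer K ((fun a : Module.End ℚ V => a.baseChange K) '' (H.endAlg : Set (Module.End ℚ V))))
      (k : κ) (x : K ⊗[ℚ] (W k).toSubmodule),
      (W k).toSubmodule.subtype.baseChange K
          (((E c k : Subalgebra.centralizer K ((fun a : Module.End ℚ (W k).toSubmodule => a.baseChange K) ''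
            ((W k).toHodgeStructure.endAlg : Set (Module.End ℚ (W k).toSubmodule)))) : Module.End K (K ⊗[ℚ] (W k).toSubmodule)) x) =
        (c : Module.End K (K ⊗[ℚ] V)) ((W k).toSubmodule.subtype.baseChange K x))
    (hE' : ∀ (c : Subalgebra.centralizer K ((fun a : Module.End ℚ V => a.baseChange K) '' (H.endAlg : Set (Module.End ℚ V))))
      (k : κ) (x : K ⊗[ℚ] (W k).toSubmodule),
      (W k).toSubmodule.subtype.baseChange K
          (((E' c k : Subalgebra.centralizer K ((fun a : Module.End ℚ (W k).toSubmodule => a.baseChange K) ''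
            ((W k).toHodgeStructure.endAlg : Set (Module.End ℚ (W k).toSubmodule)))) : Module.End K (K ⊗[ℚ] (W k).toSubmodule)) x) =
        (c : Module.End K (K ⊗[ℚ] V)) ((W k).toSubmodule.subtype.baseChange K x)) :
    E = E' := by
  have hinj : ∀ k, Function.Injective ((W k).toSubmodule.subtype.baseChange K) := fun k => by
    rw [LinearMap.baseChange_eq_ltensor]
    exact Module.Flat.lTensor_preserves_injective_linearMap _ (W k).toSubmodule.injective_subtype
  exact funext fun c => funext fun k => Subtype.ext (LinearMap.ext fun x => hinj k (by rw [hE, hE']))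

omit [Fintype κ] [DecidableEq κ] hW in
/-- **«The involution it defines on `C(A)` is the restriction of the product of the involutions», on `K`-points**: ANY map
`E : C(H)(K) → Π_k C(W_k)(K)` over the base-changed restrictions carries the `K`-adjoint `†_K` of `ψ` to the `K`-adjoints of the
`ψ|_{W_k}`: `(E c^{†_K})_k = ((E c)_k)^{†_K}` (`(ψ|_{W_k})_K((E c)_k x, y) = ψ_K(c (ι x), ι y) = ψ_K(ι x, c^{†_K}(ι y))`).
[cite: Milne1999LefschetzClasses, §1 p. 643 and Remark 1.6 (p. 644)] [cite: Huybrechts2016K3, §3.3.5 eq. (3.3)] -/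
theorem Polarization.coe_map_centralizerAdjoint_eq_adjointBaseChange_of_forall_subtype_baseChange_apply_eq [Module.Finite ℚ V]
    (ψ : Polarization H)
    (E : Subalgebra.centralizer K ((fun a : Module.End ℚ V => a.baseChange K) '' (H.endAlg : Set (Module.End ℚ V))) →
      Π k, Subalgebra.centralizer K ((fun a : Module.End ℚ (W k).toSubmodule => a.baseChange K) ''
        ((W k).toHodgeStructure.endAlg : Set (Module.End ℚ (W k).toSubmodule))))
    (hE : ∀ (c : Subalgebra.centralizer K ((fun a : Module.End ℚ V => a.baseChange K) '' (H.endAlg : Set (Module.End ℚ V))))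
      (k : κ) (x : K ⊗[ℚ] (W k).toSubmodule),
      (W k).toSubmodule.subtype.baseChange K
          (((E c k : Subalgebra.centralizer K ((fun a : Module.End ℚ (W k).toSubmodule => a.baseChange K) ''
            ((W k).toHodgeStructure.endAlg : Set (Module.End ℚ (W k).toSubmodule)))) : Module.End K (K ⊗[ℚ] (W k).toSubmodule)) x) =
        (c : Module.End K (K ⊗[ℚ] V)) ((W k).toSubmodule.subtype.baseChange K x))
    (c : Subalgebra.centralizer K ((fun a : Module.End ℚ V => a.baseChange K) '' (H.endAlg : Set (Module.End ℚ V)))) (k : κ) :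
    ((E (ψ.centralizerAdjoint K c) k : Subalgebra.centralizer K ((fun a : Module.End ℚ (W k).toSubmodule => a.baseChange K) ''
        ((W k).toHodgeStructure.endAlg : Set (Module.End ℚ (W k).toSubmodule)))) : Module.End K (K ⊗[ℚ] (W k).toSubmodule)) =
      (ψ.restrict (W k)).adjointBaseChange K ((E c k : Subalgebra.centralizer K ((fun a : Module.End ℚ (W k).toSubmodule =>
        a.baseChange K) '' ((W k).toHodgeStructure.endAlg : Set (Module.End ℚ (W k).toSubmodule)))) :
          Module.End K (K ⊗[ℚ] (W k).toSubmodule)) := by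
  refine (ψ.restrict (W k)).eq_adjointBaseChange_of_isAdjointPair K fun x y => ?_
  rw [ψ.restrict_form_baseChange_apply K (W k), ψ.restrict_form_baseChange_apply K (W k), hE, hE,
    Polarization.coe_centralizerAdjoint, ψ.baseChange_form_apply_adjointBaseChange K]

omit [Fintype κ] [DecidableEq κ] hW in
/-- The `i`-th component of `K ⊗ Π_i B_i = Π_i K ⊗ B_i` (`Algebra.TensorProduct.piRight`) is `K ⊗ (evaluation at i)`.
[cite: BourbakiAlgebraI1989, Ch. II §5 no. 3 (17)–(18) and §3 no. 7] -/
theorem piRight_apply_eq_map_evalAlgHom {ι : Type*} [Fintype ι] [DecidableEq ι] (B : ι → Type*) [∀ i, Semiring (B i)]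
    [∀ i, Algebra ℚ (B i)] (w : K ⊗[ℚ] (Π i, B i)) (i : ι) :
    Algebra.TensorProduct.piRight ℚ K K B w i = Algebra.TensorProduct.map (AlgHom.id K K) (Pi.evalAlgHom ℚ B i) w := by
  induction w using TensorProduct.induction_on with
  | zero => rw [map_zero, Pi.zero_apply, map_zero]
  | add w w' hw hw' => rw [map_add, Pi.add_apply, map_add, hw, hw']
  | tmul a f => rw [Algebra.TensorProduct.piRight_tmul, Algebra.TensorProduct.map_tmul, AlgHom.coe_id, id_eq, Pi.evalAlgHom_apply]

omit hW in
set_option maxHeartbeats 800000 in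
-- (the structure isomorphisms `K ⊗ Π_k C(W_k) ≃ Π_k K ⊗ C(W_k) ≃ Π_k C(W_k)(K)` are slow to unify at this size)
/-- **Base change of a block homomorphism over the restrictions**: for ANY `ℚ`-algebra homomorphism `φ : C(H) → Π_k C(W_k)` over the
restrictions (`(φ c)_k v = c v`) and any isomorphisms `κ_H : K ⊗_ℚ C(H) ⥲ C(H)(K)`, `κ_k : K ⊗_ℚ C(W_k) ⥲ C(W_k)(K)` of Remark 1.6's
shape (`k' ⊗ γ ↦ k' · γ_K`, g53-#5), the `K`-algebra homomorphism `(Π_k κ_k) ∘ (K ⊗ Π = Π K ⊗) ∘ (K ⊗ φ)` lies over the base-changed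
restrictions relative to `κ_H`: `(ι_k)_K (((Π κ) (piRight ((K ⊗ φ) y)))_k x) = (κ_H y) ((ι_k)_K x)` (componentwise, then induction on
`y ∈ K ⊗ C(H)`; on `k' ⊗ γ` both sides are `k' · (γ ∘ ι_k)_K x`). [cite: Milne1999LefschetzClasses, §1 p. 643 L13–L15 and Remark 1.6 (p. 644)]
[cite: BourbakiAlgebraI1989, Ch. II §5 no. 3 Prop. 7 and (17)–(18)] -/
theorem subtype_baseChange_piRight_map_apply_eq
    (φ : Subalgebra.centralizer ℚ (H.endAlg : Set (Module.End ℚ V)) →ₐ[ℚ]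
      Π k, Subalgebra.centralizer ℚ ((W k).toHodgeStructure.endAlg : Set (Module.End ℚ (W k).toSubmodule)))
    (hφ : ∀ (c : Subalgebra.centralizer ℚ (H.endAlg : Set (Module.End ℚ V))) (k : κ) (v : (W k).toSubmodule),
      ((φ c k : Module.End ℚ (W k).toSubmodule) v : V) = (c : Module.End ℚ V) v)
    (eH : K ⊗[ℚ] Subalgebra.centralizer ℚ (H.endAlg : Set (Module.End ℚ V)) ≃ₐ[K]
      Subalgebra.centralizer K ((fun a : Module.End ℚ V => a.baseChange K) '' (H.endAlg : Set (Module.End ℚ V))))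
    (heH : ∀ (a : K) (γ : Subalgebra.centralizer ℚ (H.endAlg : Set (Module.End ℚ V))),
      ((eH (a ⊗ₜ[ℚ] γ) : Subalgebra.centralizer K ((fun a : Module.End ℚ V => a.baseChange K) ''
          (H.endAlg : Set (Module.End ℚ V)))) : Module.End K (K ⊗[ℚ] V)) = a • (γ : Module.End ℚ V).baseChange K)
    (eW : ∀ k, K ⊗[ℚ] Subalgebra.centralizer ℚ ((W k).toHodgeStructure.endAlg : Set (Module.End ℚ (W k).toSubmodule)) ≃ₐ[K]
      Subalgebra.centralizer K ((fun a : Module.End ℚ (W k).toSubmodule => a.baseChange K) ''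
        ((W k).toHodgeStructure.endAlg : Set (Module.End ℚ (W k).toSubmodule))))
    (heW : ∀ (k : κ) (a : K) (γ : Subalgebra.centralizer ℚ ((W k).toHodgeStructure.endAlg : Set (Module.End ℚ (W k).toSubmodule))),
      ((eW k (a ⊗ₜ[ℚ] γ) : Subalgebra.centralizer K ((fun a : Module.End ℚ (W k).toSubmodule => a.baseChange K) ''
          ((W k).toHodgeStructure.endAlg : Set (Module.End ℚ (W k).toSubmodule)))) : Module.End K (K ⊗[ℚ] (W k).toSubmodule)) =
        a • (γ : Module.End ℚ (W k).toSubmodule).baseChange K)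
    (y : K ⊗[ℚ] Subalgebra.centralizer ℚ (H.endAlg : Set (Module.End ℚ V))) (k : κ) (x : K ⊗[ℚ] (W k).toSubmodule) :
    (W k).toSubmodule.subtype.baseChange K
        ((((AlgEquiv.piCongrRight eW) ((Algebra.TensorProduct.piRight ℚ K K fun k : κ =>
            Subalgebra.centralizer ℚ ((W k).toHodgeStructure.endAlg : Set (Module.End ℚ (W k).toSubmodule)))
              ((Algebra.TensorProduct.map ((AlgEquiv.refl : K ≃ₐ[K] K) : K →ₐ[K] K) φ) y)) k : Subalgebra.centralizer K
                ((fun a : Module.End ℚ (W k).toSubmodule => a.baseChange K) ''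
                  ((W k).toHodgeStructure.endAlg : Set (Module.End ℚ (W k).toSubmodule)))) :
                    Module.End K (K ⊗[ℚ] (W k).toSubmodule)) x) =
      ((eH y : Subalgebra.centralizer K ((fun a : Module.End ℚ V => a.baseChange K) '' (H.endAlg : Set (Module.End ℚ V)))) :
        Module.End K (K ⊗[ℚ] V)) ((W k).toSubmodule.subtype.baseChange K x) := by
  rw [AlgEquiv.piCongrRight_apply, piRight_apply_eq_map_evalAlgHom]
  induction y using TensorProduct.induction_on generalizing x with
  | zero =>
    rw [map_zero (Algebra.TensorProduct.map ((AlgEquiv.refl : K ≃ₐ[K] K) : K →ₐ[K] K) φ),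
      map_zero (Algebra.TensorProduct.map (AlgHom.id K K) (Pi.evalAlgHom ℚ (fun k : κ =>
        Subalgebra.centralizer ℚ ((W k).toHodgeStructure.endAlg : Set (Module.End ℚ (W k).toSubmodule))) k)),
      map_zero (eW k), map_zero eH, ZeroMemClass.coe_zero, ZeroMemClass.coe_zero, LinearMap.zero_apply, LinearMap.zero_apply, map_zero]
  | add y y' hy hy' =>
    rw [map_add (Algebra.TensorProduct.map ((AlgEquiv.refl : K ≃ₐ[K] K) : K →ₐ[K] K) φ),
      map_add (Algebra.TensorProduct.map (AlgHom.id K K) (Pi.evalAlgHom ℚ (fun k : κ =>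
        Subalgebra.centralizer ℚ ((W k).toHodgeStructure.endAlg : Set (Module.End ℚ (W k).toSubmodule))) k)),
      map_add (eW k), map_add eH, AddMemClass.coe_add, AddMemClass.coe_add, LinearMap.add_apply, LinearMap.add_apply, map_add, hy, hy']
  | tmul a γ =>
    rw [Algebra.TensorProduct.map_tmul, Algebra.TensorProduct.map_tmul, AlgHom.coe_id, id_eq, Pi.evalAlgHom_apply, heW, heH]
    simp only [AlgEquiv.coe_toAlgHom, AlgEquiv.coe_refl, id_eq]
    rw [LinearMap.smul_apply, LinearMap.smul_apply, map_smul,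
      ← LinearMap.comp_apply ((W k).toSubmodule.subtype.baseChange K), ← LinearMap.baseChange_comp,
      subtype_comp_coe_pi_eq_of_forall_coe_apply_eq W φ hφ γ k, LinearMap.baseChange_comp, LinearMap.comp_apply]

/-- **«`C(B) ⊂ C(A₁) × ⋯ × C(A_s)`» ON `K`-POINTS: restriction to the base-changed blocks is an INJECTIVE homomorphism of
`K`-algebras `r : C(H)(K) →ₐ[K] Π_k C(W_k)(K)`, `(ι_k)_K ((r c)_k x) = c ((ι_k)_K x)`**, for every internal direct sum `V = ⊕_k W_k` of
sub-Hodge structures of a finite-dimensional `H` and every field `K ⊇ ℚ` — the base change `K ⊗_ℚ r₀` of g52-#3's restriction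
`r₀ : C(H) ↪ Π_k C(W_k)`, transported through Remark 1.6 (`C(·)(K) ≅ K ⊗_ℚ C(·)`, g53-#5) and `K ⊗ Π_k = Π_k K ⊗`; injective because
`c` is determined by the `c ∘ (ι_k)_K`. [cite: Milne1999LefschetzClasses, §1 p. 643 L13–L15 and Remark 1.6 (p. 644)] [cite: Moonen2004MT, §4 Lemma 4.6] -/
theorem exists_algHom_pi_centralizer_baseChange [Module.Finite ℚ V] :
    ∃ r : Subalgebra.centralizer K ((fun a : Module.End ℚ V => a.baseChange K) '' (H.endAlg : Set (Module.End ℚ V))) →ₐ[K]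
        Π k, Subalgebra.centralizer K ((fun a : Module.End ℚ (W k).toSubmodule => a.baseChange K) ''
          ((W k).toHodgeStructure.endAlg : Set (Module.End ℚ (W k).toSubmodule))),
      (∀ (c : Subalgebra.centralizer K ((fun a : Module.End ℚ V => a.baseChange K) '' (H.endAlg : Set (Module.End ℚ V))))
          (k : κ) (x : K ⊗[ℚ] (W k).toSubmodule),
        (W k).toSubmodule.subtype.baseChange K
            (((r c k : Subalgebra.centralizer K ((fun a : Module.End ℚ (W k).toSubmodule => a.baseChange K) ''
              ((W k).toHodgeStructure.endAlg : Set (Module.End ℚ (W k).toSubmodule)))) : Module.End K (K ⊗[ℚ] (W k).toSubmodule)) x) =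
          (c : Module.End K (K ⊗[ℚ] V)) ((W k).toSubmodule.subtype.baseChange K x)) ∧
      Function.Injective r := by
  obtain ⟨r₀, hr₀, -⟩ := exists_algHom_pi_centralizer W hW
  obtain ⟨eH, heH⟩ := exists_baseChange_centralizer_algEquiv K H
  choose eW heW using fun k : κ => exists_baseChange_centralizer_algEquiv K (W k).toHodgeStructure
  let r : Subalgebra.centralizer K ((fun a : Module.End ℚ V => a.baseChange K) '' (H.endAlg : Set (Module.End ℚ V))) →ₐ[K]
      Π k, Subalgebra.centralizer K ((fun a : Module.End ℚ (W k).toSubmodule => a.baseChange K) ''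
        ((W k).toHodgeStructure.endAlg : Set (Module.End ℚ (W k).toSubmodule))) :=
    (((AlgEquiv.piCongrRight eW).toAlgHom.comp ((Algebra.TensorProduct.piRight ℚ K K fun k : κ =>
      Subalgebra.centralizer ℚ ((W k).toHodgeStructure.endAlg : Set (Module.End ℚ (W k).toSubmodule))).toAlgHom.comp
        (Algebra.TensorProduct.map ((AlgEquiv.refl : K ≃ₐ[K] K) : K →ₐ[K] K) r₀)))).comp eH.symm.toAlgHom
  have hr : ∀ (c : Subalgebra.centralizer K ((fun a : Module.End ℚ V => a.baseChange K) '' (H.endAlg : Set (Module.End ℚ V))))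
      (k : κ) (x : K ⊗[ℚ] (W k).toSubmodule),
      (W k).toSubmodule.subtype.baseChange K
          (((r c k : Subalgebra.centralizer K ((fun a : Module.End ℚ (W k).toSubmodule => a.baseChange K) ''
            ((W k).toHodgeStructure.endAlg : Set (Module.End ℚ (W k).toSubmodule)))) : Module.End K (K ⊗[ℚ] (W k).toSubmodule)) x) =
        (c : Module.End K (K ⊗[ℚ] V)) ((W k).toSubmodule.subtype.baseChange K x) := fun c k x => by
    have h := subtype_baseChange_piRight_map_apply_eq K W r₀ hr₀ eH heH eW heW (eH.symm c) k x
    rw [AlgEquiv.apply_symm_apply] at h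
    exact h
  refine ⟨r, hr, fun c c' h => Subtype.ext (linearMap_eq_of_forall_apply_subtype_baseChange_eq K W hW _ _ fun k x => ?_)⟩
  rw [← hr, ← hr, h]

/-! ## §2 «With equality holding if and only if `Hom(Aᵢ, Aⱼ) = 0`», on `K`-points -/

/-- **«with equality iff `Hom(Aᵢ, Aⱼ) = 0`», dimension form on `K`-points**: `dim_K C(H)(K) = Σ_k dim_K C(W_k)(K)` iff the blocks are
Hom-orthogonal — `dim_K C(·)(K) = dim_ℚ C(·)` (Remark 1.6, g53-#5) and g52-#7's `ℚ`-criterion.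
[cite: Milne1999LefschetzClasses, §1 p. 643 L13–L15 and Remark 1.6 (p. 644)] -/
theorem finrank_centralizer_baseChange_eq_sum_iff_hom_orthogonal [Module.Finite ℚ V] :
    Module.finrank K (Subalgebra.centralizer K ((fun a : Module.End ℚ V => a.baseChange K) '' (H.endAlg : Set (Module.End ℚ V)))) =
        ∑ k, Module.finrank K (Subalgebra.centralizer K ((fun a : Module.End ℚ (W k).toSubmodule => a.baseChange K) ''
          ((W k).toHodgeStructure.endAlg : Set (Module.End ℚ (W k).toSubmodule)))) ↔
      ∀ k l, k ≠ l → ∀ f : Hom (W k).toHodgeStructure (W l).toHodgeStructure, f = 0 := by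
  rw [finrank_centralizer_endAlg_baseChange_eq K H]
  simp only [finrank_centralizer_endAlg_baseChange_eq]
  exact finrank_centralizer_eq_sum_iff_hom_orthogonal W hW

/-- **`C(H)(K) ≃ₐ[K] Π_k C(W_k)(K)` BY RESTRICTION, `(ι_k)_K ((E c)_k x) = c ((ι_k)_K x)`, along a Hom-orthogonal internal direct sum**
(«equality holding if `Hom(Aᵢ, Aⱼ) = 0`», on `K`-points): the base change `(Π_k κ_{W_k}) ∘ piRight ∘ (K ⊗ e) ∘ κ_H⁻¹` of g52-#3's
`ℚ`-isomorphism `e : C(H) ⥲ Π_k C(W_k)`. [cite: Milne1999LefschetzClasses, §1 p. 643 L13–L15, Prop. 1.1 and Remark 1.6 (p. 644)]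
[cite: Moonen2004MT, §4 Lemma 4.6] -/
theorem exists_algEquiv_pi_centralizer_baseChange_of_hom_orthogonal [Module.Finite ℚ V]
    (horth : ∀ k l, k ≠ l → ∀ f : Hom (W k).toHodgeStructure (W l).toHodgeStructure, f = 0) :
    ∃ E : Subalgebra.centralizer K ((fun a : Module.End ℚ V => a.baseChange K) '' (H.endAlg : Set (Module.End ℚ V))) ≃ₐ[K]
        Π k, Subalgebra.centralizer K ((fun a : Module.End ℚ (W k).toSubmodule => a.baseChange K) ''
          ((W k).toHodgeStructure.endAlg : Set (Module.End ℚ (W k).toSubmodule))),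
      ∀ (c : Subalgebra.centralizer K ((fun a : Module.End ℚ V => a.baseChange K) '' (H.endAlg : Set (Module.End ℚ V))))
        (k : κ) (x : K ⊗[ℚ] (W k).toSubmodule),
        (W k).toSubmodule.subtype.baseChange K
            (((E c k : Subalgebra.centralizer K ((fun a : Module.End ℚ (W k).toSubmodule => a.baseChange K) ''
              ((W k).toHodgeStructure.endAlg : Set (Module.End ℚ (W k).toSubmodule)))) : Module.End K (K ⊗[ℚ] (W k).toSubmodule)) x) =
          (c : Module.End K (K ⊗[ℚ] V)) ((W k).toSubmodule.subtype.baseChange K x) := by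
  obtain ⟨e, he⟩ := exists_algEquiv_pi_centralizer_of_hom_orthogonal W hW horth
  obtain ⟨eH, heH⟩ := exists_baseChange_centralizer_algEquiv K H
  choose eW heW using fun k : κ => exists_baseChange_centralizer_algEquiv K (W k).toHodgeStructure
  refine ⟨eH.symm.trans ((Algebra.TensorProduct.congr (AlgEquiv.refl : K ≃ₐ[K] K) e).trans
    ((Algebra.TensorProduct.piRight ℚ K K fun k : κ =>
      Subalgebra.centralizer ℚ ((W k).toHodgeStructure.endAlg : Set (Module.End ℚ (W k).toSubmodule))).trans
        (AlgEquiv.piCongrRight eW))), fun c k x => ?_⟩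
  have h := subtype_baseChange_piRight_map_apply_eq K W (e : _ →ₐ[ℚ] _) (fun c k v => he c k v) eH heH eW heW (eH.symm c) k x
  rw [AlgEquiv.apply_symm_apply] at h
  rw [AlgEquiv.trans_apply, AlgEquiv.trans_apply, AlgEquiv.trans_apply, Algebra.TensorProduct.congr_apply]
  exact h

/-- **`C(H)(K) ≃ₐ[K] Π_k C(W_k)(K)` by restriction along an internal direct sum into `E_φ`-STABLE sub-Hodge structures** (stable blocks
are Hom-orthogonal, g52-#3). [cite: Milne1999LefschetzClasses, §1 p. 643 L13–L15, Prop. 1.1 and Remark 1.6 (p. 644)] -/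
theorem exists_algEquiv_pi_centralizer_baseChange_of_forall_stable [Module.Finite ℚ V]
    (hst : ∀ k, ∀ a ∈ H.endAlg, ∀ v ∈ (W k).toSubmodule, a v ∈ (W k).toSubmodule) :
    ∃ E : Subalgebra.centralizer K ((fun a : Module.End ℚ V => a.baseChange K) '' (H.endAlg : Set (Module.End ℚ V))) ≃ₐ[K]
        Π k, Subalgebra.centralizer K ((fun a : Module.End ℚ (W k).toSubmodule => a.baseChange K) ''
          ((W k).toHodgeStructure.endAlg : Set (Module.End ℚ (W k).toSubmodule))),
      ∀ (c : Subalgebra.centralizer K ((fun a : Module.End ℚ V => a.baseChange K) '' (H.endAlg : Set (Module.End ℚ V))))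
        (k : κ) (x : K ⊗[ℚ] (W k).toSubmodule),
        (W k).toSubmodule.subtype.baseChange K
            (((E c k : Subalgebra.centralizer K ((fun a : Module.End ℚ (W k).toSubmodule => a.baseChange K) ''
              ((W k).toHodgeStructure.endAlg : Set (Module.End ℚ (W k).toSubmodule)))) : Module.End K (K ⊗[ℚ] (W k).toSubmodule)) x) =
          (c : Module.End K (K ⊗[ℚ] V)) ((W k).toSubmodule.subtype.baseChange K x) :=
  exists_algEquiv_pi_centralizer_baseChange_of_hom_orthogonal K W hW fun _ _ hkl f => hom_eq_zero_of_forall_stable W hW hst hkl f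

/-- **PROP. 1.1 ON `K`-POINTS ALONG HOM-ORTHOGONAL BLOCKS, «OF `k`-ALGEBRAS WITH INVOLUTION»**: the restriction isomorphism
`E : C(H)(K) ≃ₐ[K] Π_k C(W_k)(K)` together with `(E c^{†_K})_k = ((E c)_k)^{†_K}` for a polarization `ψ` and the restricted
polarizations `ψ|_{W_k}`. [cite: Milne1999LefschetzClasses, §1 p. 643, Prop. 1.1 and Remark 1.6 (p. 644)] [cite: Huybrechts2016K3, §3.3.5 eq. (3.3)] -/
theorem Polarization.exists_algEquiv_pi_centralizer_baseChange_adjoint_of_hom_orthogonal [Module.Finite ℚ V] (ψ : Polarization H)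
    (horth : ∀ k l, k ≠ l → ∀ f : Hom (W k).toHodgeStructure (W l).toHodgeStructure, f = 0) :
    ∃ E : Subalgebra.centralizer K ((fun a : Module.End ℚ V => a.baseChange K) '' (H.endAlg : Set (Module.End ℚ V))) ≃ₐ[K]
        Π k, Subalgebra.centralizer K ((fun a : Module.End ℚ (W k).toSubmodule => a.baseChange K) ''
          ((W k).toHodgeStructure.endAlg : Set (Module.End ℚ (W k).toSubmodule))),
      (∀ (c : Subalgebra.centralizer K ((fun a : Module.End ℚ V => a.baseChange K) '' (H.endAlg : Set (Module.End ℚ V))))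
          (k : κ) (x : K ⊗[ℚ] (W k).toSubmodule),
        (W k).toSubmodule.subtype.baseChange K
            (((E c k : Subalgebra.centralizer K ((fun a : Module.End ℚ (W k).toSubmodule => a.baseChange K) ''
              ((W k).toHodgeStructure.endAlg : Set (Module.End ℚ (W k).toSubmodule)))) : Module.End K (K ⊗[ℚ] (W k).toSubmodule)) x) =
          (c : Module.End K (K ⊗[ℚ] V)) ((W k).toSubmodule.subtype.baseChange K x)) ∧
      ∀ (c : Subalgebra.centralizer K ((fun a : Module.End ℚ V => a.baseChange K) '' (H.endAlg : Set (Module.End ℚ V)))) (k : κ),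
        ((E (ψ.centralizerAdjoint K c) k : Subalgebra.centralizer K ((fun a : Module.End ℚ (W k).toSubmodule => a.baseChange K) ''
            ((W k).toHodgeStructure.endAlg : Set (Module.End ℚ (W k).toSubmodule)))) : Module.End K (K ⊗[ℚ] (W k).toSubmodule)) =
          (ψ.restrict (W k)).adjointBaseChange K ((E c k : Subalgebra.centralizer K ((fun a : Module.End ℚ (W k).toSubmodule =>
            a.baseChange K) '' ((W k).toHodgeStructure.endAlg : Set (Module.End ℚ (W k).toSubmodule)))) :
              Module.End K (K ⊗[ℚ] (W k).toSubmodule)) := by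
  obtain ⟨E, hE⟩ := exists_algEquiv_pi_centralizer_baseChange_of_hom_orthogonal K W hW horth
  exact ⟨E, hE, fun c k =>
    ψ.coe_map_centralizerAdjoint_eq_adjointBaseChange_of_forall_subtype_baseChange_apply_eq K W E hE c k⟩

omit [Fintype κ] [DecidableEq κ] hW in
/-- `w ↦ 1 ⊗ w : W → K ⊗_ℚ W` is injective: a `ℚ`-linear retraction `λ` of `ℚ → K` gives `(λ ⊗ W)(1 ⊗ w) = λ(1) · w = w`.
[cite: BourbakiAlgebraI1989, Ch. II §5 no. 3 Prop. 7] -/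
theorem eq_zero_of_one_tmul_eq_zero {M : Type*} [AddCommGroup M] [Module ℚ M] {w : M} (hw : (1 : K) ⊗ₜ[ℚ] w = 0) : w = 0 := by
  obtain ⟨l, hl⟩ := LinearMap.exists_leftInverse_of_injective (Algebra.linearMap ℚ K)
    (LinearMap.ker_eq_bot.2 (algebraMap ℚ K).injective)
  have hl1 : l (1 : K) = 1 := by
    have h := LinearMap.congr_fun hl (1 : ℚ)
    rwa [LinearMap.comp_apply, Algebra.linearMap_apply, map_one, LinearMap.id_apply] at h
  have h := congrArg (fun t => TensorProduct.lid ℚ M (l.rTensor M t)) hw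
  simp only [LinearMap.rTensor_tmul, TensorProduct.lid_tmul, map_zero, hl1, one_smul] at h
  exact h

omit [Fintype κ] in
/-- **«equality holding ⟹ `Hom(Aᵢ, Aⱼ) = 0` for `i ≠ j`», on `K`-points** (Milne's argument, verbatim on `K`-points): if EVERY family
`(d_k ∈ C(W_k)(K))_k` is the family of restrictions of some `c ∈ C(H)(K)`, the blocks are Hom-orthogonal — lift `(1_{K ⊗ W_k}, 0, …, 0)`
to `c`; `c` commutes with `a_K` for the Hodge endomorphism `a = ι_l ∘ f ∘ π_k` of a morphism `f : W_k → W_l`, so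
`(ι_l)_K (f_K x) = a_K (c ((ι_k)_K x)) = c ((ι_l)_K (f_K x)) = 0`, whence `f_K = 0` and `f = 0` (`1 ⊗ f v = 0 ⟹ f v = 0`).
[cite: Milne1999LefschetzClasses, §1 p. 643 L13–L15 and Remark 1.6 (p. 644)] [cite: VoisinHodgeI2002, §7.3.1 Lemma 7.26] -/
theorem hom_eq_zero_of_forall_exists_centralizer_baseChange_lift
    (hlift : ∀ d : Π k, Subalgebra.centralizer K ((fun a : Module.End ℚ (W k).toSubmodule => a.baseChange K) ''
        ((W k).toHodgeStructure.endAlg : Set (Module.End ℚ (W k).toSubmodule))),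
      ∃ c : Subalgebra.centralizer K ((fun a : Module.End ℚ V => a.baseChange K) '' (H.endAlg : Set (Module.End ℚ V))),
        ∀ (k : κ) (x : K ⊗[ℚ] (W k).toSubmodule),
          (W k).toSubmodule.subtype.baseChange K
              (((d k : Subalgebra.centralizer K ((fun a : Module.End ℚ (W k).toSubmodule => a.baseChange K) ''
                ((W k).toHodgeStructure.endAlg : Set (Module.End ℚ (W k).toSubmodule)))) : Module.End K (K ⊗[ℚ] (W k).toSubmodule)) x) =
            (c : Module.End K (K ⊗[ℚ] V)) ((W k).toSubmodule.subtype.baseChange K x))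
    {k l : κ} (hkl : k ≠ l) (f : Hom (W k).toHodgeStructure (W l).toHodgeStructure) : f = 0 := by
  obtain ⟨c, hc⟩ := hlift (Pi.single k 1)
  obtain ⟨a, ha, hax⟩ := exists_mem_endAlg_apply_coe_eq W hW k l f
  have haι : a ∘ₗ (W k).toSubmodule.subtype = (W l).toSubmodule.subtype ∘ₗ f.toLinearMap := LinearMap.ext fun x => hax x
  have hcomm : a.baseChange K * (c : Module.End K (K ⊗[ℚ] V)) = (c : Module.End K (K ⊗[ℚ] V)) * a.baseChange K :=
    (Subalgebra.mem_centralizer_iff K).1 c.2 _ ⟨a, ha, rfl⟩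
  -- `c` is the identity on `K ⊗ W_k` and zero on `K ⊗ W_l`
  have h1 : ∀ x : K ⊗[ℚ] (W k).toSubmodule,
      (c : Module.End K (K ⊗[ℚ] V)) ((W k).toSubmodule.subtype.baseChange K x) = (W k).toSubmodule.subtype.baseChange K x := fun x => by
    rw [← hc k x, Pi.single_eq_same, OneMemClass.coe_one, Module.End.one_apply]
  have h2 : ∀ y : K ⊗[ℚ] (W l).toSubmodule, (c : Module.End K (K ⊗[ℚ] V)) ((W l).toSubmodule.subtype.baseChange K y) = 0 := fun y => by
    rw [← hc l y, Pi.single_eq_of_ne' hkl, ZeroMemClass.coe_zero, LinearMap.zero_apply, map_zero]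
  -- hence `(ι_l)_K ∘ f_K = 0`
  have hfK : ∀ x : K ⊗[ℚ] (W k).toSubmodule, (W l).toSubmodule.subtype.baseChange K (f.toLinearMap.baseChange K x) = 0 := fun x => by
    have h := LinearMap.congr_fun hcomm ((W k).toSubmodule.subtype.baseChange K x)
    rw [Module.End.mul_apply, Module.End.mul_apply, h1, ← LinearMap.comp_apply (a.baseChange K), ← LinearMap.baseChange_comp, haι,
      LinearMap.baseChange_comp, LinearMap.comp_apply, h2] at h
    exact h
  have hι : Function.Injective ((W l).toSubmodule.subtype.baseChange K) := by
    rw [LinearMap.baseChange_eq_ltensor]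
    exact Module.Flat.lTensor_preserves_injective_linearMap _ (W l).toSubmodule.injective_subtype
  refine Hom.ext (LinearMap.ext fun v => ?_)
  have h0 : f.toLinearMap.baseChange K ((1 : K) ⊗ₜ[ℚ] v) = 0 := hι (by rw [hfK, map_zero])
  rw [LinearMap.baseChange_tmul] at h0
  rw [Hom.zero_toLinearMap, LinearMap.zero_apply]
  exact eq_zero_of_one_tmul_eq_zero K h0

/-- **«with equality holding if and only if `Hom(Aᵢ, Aⱼ) = 0`», lifting form on `K`-points**: every family `d_k ∈ C(W_k)(K)` is the
family of restrictions of some `c ∈ C(H)(K)` iff the blocks are Hom-orthogonal (⟸: `c = E⁻¹ d` for the restriction isomorphism `E`).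
[cite: Milne1999LefschetzClasses, §1 p. 643 L13–L15 and Remark 1.6 (p. 644)] [cite: Moonen2004MT, §4 Lemma 4.6] -/
theorem forall_exists_centralizer_baseChange_lift_iff_hom_orthogonal [Module.Finite ℚ V] :
    (∀ d : Π k, Subalgebra.centralizer K ((fun a : Module.End ℚ (W k).toSubmodule => a.baseChange K) ''
        ((W k).toHodgeStructure.endAlg : Set (Module.End ℚ (W k).toSubmodule))),
      ∃ c : Subalgebra.centralizer K ((fun a : Module.End ℚ V => a.baseChange K) '' (H.endAlg : Set (Module.End ℚ V))),
        ∀ (k : κ) (x : K ⊗[ℚ] (W k).toSubmodule),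
          (W k).toSubmodule.subtype.baseChange K
              (((d k : Subalgebra.centralizer K ((fun a : Module.End ℚ (W k).toSubmodule => a.baseChange K) ''
                ((W k).toHodgeStructure.endAlg : Set (Module.End ℚ (W k).toSubmodule)))) : Module.End K (K ⊗[ℚ] (W k).toSubmodule)) x) =
            (c : Module.End K (K ⊗[ℚ] V)) ((W k).toSubmodule.subtype.baseChange K x)) ↔
      ∀ k l, k ≠ l → ∀ f : Hom (W k).toHodgeStructure (W l).toHodgeStructure, f = 0 := by
  refine ⟨fun hlift _ _ hkl f => hom_eq_zero_of_forall_exists_centralizer_baseChange_lift K W hW hlift hkl f, fun horth d => ?_⟩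
  obtain ⟨E, hE⟩ := exists_algEquiv_pi_centralizer_baseChange_of_hom_orthogonal K W hW horth
  refine ⟨E.symm d, fun k x => ?_⟩
  rw [← hE (E.symm d) k x, AlgEquiv.apply_symm_apply]

/-- **«with equality holding if and only if `Hom(Aᵢ, Aⱼ) = 0`», isomorphism form on `K`-points**: there is an isomorphism of
`K`-algebras `C(H)(K) ≃ₐ[K] Π_k C(W_k)(K)` lying over the base-changed restrictions iff the blocks are Hom-orthogonal (⟹: `E⁻¹` lifts
every family). [cite: Milne1999LefschetzClasses, §1 p. 643 L13–L15, Prop. 1.1 and Remark 1.6 (p. 644)] -/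
theorem exists_algEquiv_pi_centralizer_baseChange_iff_hom_orthogonal [Module.Finite ℚ V] :
    (∃ E : Subalgebra.centralizer K ((fun a : Module.End ℚ V => a.baseChange K) '' (H.endAlg : Set (Module.End ℚ V))) ≃ₐ[K]
        Π k, Subalgebra.centralizer K ((fun a : Module.End ℚ (W k).toSubmodule => a.baseChange K) ''
          ((W k).toHodgeStructure.endAlg : Set (Module.End ℚ (W k).toSubmodule))),
      ∀ (c : Subalgebra.centralizer K ((fun a : Module.End ℚ V => a.baseChange K) '' (H.endAlg : Set (Module.End ℚ V))))
        (k : κ) (x : K ⊗[ℚ] (W k).toSubmodule),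
        (W k).toSubmodule.subtype.baseChange K
            (((E c k : Subalgebra.centralizer K ((fun a : Module.End ℚ (W k).toSubmodule => a.baseChange K) ''
              ((W k).toHodgeStructure.endAlg : Set (Module.End ℚ (W k).toSubmodule)))) : Module.End K (K ⊗[ℚ] (W k).toSubmodule)) x) =
          (c : Module.End K (K ⊗[ℚ] V)) ((W k).toSubmodule.subtype.baseChange K x)) ↔
      ∀ k l, k ≠ l → ∀ f : Hom (W k).toHodgeStructure (W l).toHodgeStructure, f = 0 := by
  refine ⟨fun ⟨E, hE⟩ => (forall_exists_centralizer_baseChange_lift_iff_hom_orthogonal K W hW).1 fun d => ?_,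
    fun horth => exists_algEquiv_pi_centralizer_baseChange_of_hom_orthogonal K W hW horth⟩
  refine ⟨E.symm d, fun k x => ?_⟩
  rw [← hE (E.symm d) k x, AlgEquiv.apply_symm_apply]

end Blocks

/-! ## §3 Over the canonical blocks of a polarized `H` -/

section Canonical

variable [Module.Finite ℚ V]

open Classical in
/-- **`(C(H)(K), †_K) ≃ₐ Π_S (C(S)(K), †_K)` BY RESTRICTION OVER THE CANONICAL BLOCKS** — Prop. 1.1 on `K`-points, intrinsically:
along the decomposition `V = ⊕_S S` of a polarized finite-dimensional `ℚ`-Hodge structure into its minimal `E_φ`-stable sub-Hodge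
structures (Hom-orthogonal, g51) restriction is an isomorphism of `K`-algebras with involution, `(ι_S)_K ((E c)_S x) = c ((ι_S)_K x)`.
[cite: Milne1999LefschetzClasses, §1 p. 643 L13–L15, Prop. 1.1 and Remark 1.6 (p. 644)] [cite: Lange2023AbelianVarietiesComplex, §2.4.4 Cor. 2.4.26 (p. 124)] -/
theorem Polarization.exists_algEquiv_pi_centralizer_baseChange_minimal_stable_adjoint (ψ : Polarization H) :
    ∃ E : Subalgebra.centralizer K ((fun a : Module.End ℚ V => a.baseChange K) '' (H.endAlg : Set (Module.End ℚ V))) ≃ₐ[K]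
        Π S : {S : SubHodgeStructure H // (∀ a ∈ H.endAlg, ∀ v ∈ S.toSubmodule, a v ∈ S.toSubmodule) ∧ S.toSubmodule ≠ ⊥ ∧
          ∀ S' : SubHodgeStructure H, (∀ a ∈ H.endAlg, ∀ v ∈ S'.toSubmodule, a v ∈ S'.toSubmodule) →
            S'.toSubmodule ≤ S.toSubmodule → S'.toSubmodule = ⊥ ∨ S'.toSubmodule = S.toSubmodule},
          Subalgebra.centralizer K ((fun a : Module.End ℚ (S : SubHodgeStructure H).toSubmodule => a.baseChange K) ''
            ((S : SubHodgeStructure H).toHodgeStructure.endAlg : Set (Module.End ℚ (S : SubHodgeStructure H).toSubmodule))),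
      (∀ (c : Subalgebra.centralizer K ((fun a : Module.End ℚ V => a.baseChange K) '' (H.endAlg : Set (Module.End ℚ V))))
          (S : {S : SubHodgeStructure H // (∀ a ∈ H.endAlg, ∀ v ∈ S.toSubmodule, a v ∈ S.toSubmodule) ∧ S.toSubmodule ≠ ⊥ ∧
            ∀ S' : SubHodgeStructure H, (∀ a ∈ H.endAlg, ∀ v ∈ S'.toSubmodule, a v ∈ S'.toSubmodule) →
              S'.toSubmodule ≤ S.toSubmodule → S'.toSubmodule = ⊥ ∨ S'.toSubmodule = S.toSubmodule})
          (x : K ⊗[ℚ] (S : SubHodgeStructure H).toSubmodule),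
        (S : SubHodgeStructure H).toSubmodule.subtype.baseChange K
            (((E c S : Subalgebra.centralizer K ((fun a : Module.End ℚ (S : SubHodgeStructure H).toSubmodule => a.baseChange K) ''
              ((S : SubHodgeStructure H).toHodgeStructure.endAlg : Set (Module.End ℚ (S : SubHodgeStructure H).toSubmodule)))) :
                Module.End K (K ⊗[ℚ] (S : SubHodgeStructure H).toSubmodule)) x) =
          (c : Module.End K (K ⊗[ℚ] V)) ((S : SubHodgeStructure H).toSubmodule.subtype.baseChange K x)) ∧
      ∀ (c : Subalgebra.centralizer K ((fun a : Module.End ℚ V => a.baseChange K) '' (H.endAlg : Set (Module.End ℚ V))))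
          (S : {S : SubHodgeStructure H // (∀ a ∈ H.endAlg, ∀ v ∈ S.toSubmodule, a v ∈ S.toSubmodule) ∧ S.toSubmodule ≠ ⊥ ∧
            ∀ S' : SubHodgeStructure H, (∀ a ∈ H.endAlg, ∀ v ∈ S'.toSubmodule, a v ∈ S'.toSubmodule) →
              S'.toSubmodule ≤ S.toSubmodule → S'.toSubmodule = ⊥ ∨ S'.toSubmodule = S.toSubmodule}),
        ((E (ψ.centralizerAdjoint K c) S : Subalgebra.centralizer K ((fun a : Module.End ℚ (S : SubHodgeStructure H).toSubmodule =>
            a.baseChange K) '' ((S : SubHodgeStructure H).toHodgeStructure.endAlg :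
              Set (Module.End ℚ (S : SubHodgeStructure H).toSubmodule)))) : Module.End K (K ⊗[ℚ] (S : SubHodgeStructure H).toSubmodule)) =
          (ψ.restrict (S : SubHodgeStructure H)).adjointBaseChange K ((E c S : Subalgebra.centralizer K
            ((fun a : Module.End ℚ (S : SubHodgeStructure H).toSubmodule => a.baseChange K) ''
              ((S : SubHodgeStructure H).toHodgeStructure.endAlg : Set (Module.End ℚ (S : SubHodgeStructure H).toSubmodule)))) :
                Module.End K (K ⊗[ℚ] (S : SubHodgeStructure H).toSubmodule)) := by
  haveI : Fintype {S : SubHodgeStructure H // (∀ a ∈ H.endAlg, ∀ v ∈ S.toSubmodule, a v ∈ S.toSubmodule) ∧ S.toSubmodule ≠ ⊥ ∧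
      ∀ S' : SubHodgeStructure H, (∀ a ∈ H.endAlg, ∀ v ∈ S'.toSubmodule, a v ∈ S'.toSubmodule) →
        S'.toSubmodule ≤ S.toSubmodule → S'.toSubmodule = ⊥ ∨ S'.toSubmodule = S.toSubmodule} :=
    ψ.finite_setOf_minimal_stable.fintype
  exact ψ.exists_algEquiv_pi_centralizer_baseChange_adjoint_of_hom_orthogonal K
    (Subtype.val : {S : SubHodgeStructure H // (∀ a ∈ H.endAlg, ∀ v ∈ S.toSubmodule, a v ∈ S.toSubmodule) ∧ S.toSubmodule ≠ ⊥ ∧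
      ∀ S' : SubHodgeStructure H, (∀ a ∈ H.endAlg, ∀ v ∈ S'.toSubmodule, a v ∈ S'.toSubmodule) →
        S'.toSubmodule ≤ S.toSubmodule → S'.toSubmodule = ⊥ ∨ S'.toSubmodule = S.toSubmodule} → SubHodgeStructure H)
    ψ.isInternal_minimal_stable
    fun S S' hne f => ψ.hom_eq_zero_of_minimal_stable_of_ne S.2 S'.2 (fun h => hne (Subtype.ext h)) f

end Canonical

end HodgeStructure

end Literature.AlgebraicGeometry.Motives
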